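import Literature.AlgebraicGeometry.AbelianSchemes.AbelianSchemeFibreBaseChange
import Literature.AlgebraicGeometry.Limits.SubalgebraSpread
import Literature.AlgebraicGeometry.Limits.SliceBaseChange
import HarnessLib

/-!
# Spreading out a morphism into an abelian scheme from the geometric generic fibre to a stage (EGA IV₃ 8.8.2 (i))

Topic `Literature/AlgebraicGeometry/AbelianSchemes`; namespace `Literature.AlgebraicGeometry.AbelianSchemes.AbelianScheme`.
Cell `hodgecm-mathlib` (D-0151), row III-0 road of record (`A-provers/A-p14/ROAD-III0-albanese-baseChange.md`, piece F3):
to compare the Albanese variety of `Y_ℂ` with that of `Y/k` one spreads the complex Abel–Jacobi map `Y_ℂ → J(Y_ℂ) = 𝒜_ℂ`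
(`𝒜` an abelian scheme over a finitely generated `k`-subalgebra `T ⊆ ℂ`, piece F2) to a stage `T ⊆ R ⊆ ℂ` and specialises it.
THEOREMS ONLY plus two iso CONSTRUCTIONS with bodies (no named fact, no instance; debt 0).

* §1 `fibreFacIso 𝒜 φ χ ψ h : (𝒜.baseChange φ).fibre χ ≅ 𝒜.fibre ψ` for a factorisation `ψ = χ ∘ φ : T → R → κ` — the
  AbelianVariety-isomorphism over the transitivity isomorphism WITH EXPLICIT PROJECTIONS `Limits.pullbackFacObjIso`
  (`fibreFacIso_hom_hom_hom_hom`, by `rfl`; the sibling `fibreBaseChangeIso` of `AbelianSchemeFibreBaseChange` sits on Mathlib's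
  `Over.pullbackComp`, which has no component formulas); `pullback_map_one` — base change preserves the unit morphism, in
  `AbelianScheme`-typed form.
* §2 `exists_stage_hom_baseChange_eq` — for `T` of finite type over a field `k`, a ring map `ψ : T → K` to a field with
  `σ = ψ ∘ (k → T)`, an abelian scheme `𝒜/T`, a quasi-compact quasi-separated `k`-scheme `X` and a `K`-morphism
  `f : X ×_k K → 𝒜_ψ`, there are a finitely generated `T`-subalgebra `R = T[t] ⊆ K` (a domain of finite type over `k`,
  `φ : T → R`, `χ : R ⊆ K`) and an `R`-morphism `F : X ×_k R → 𝒜_R` with `F ×_R K = srcFacIso ≫ f ≫ fibreFacIso⁻¹`, mapping every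
  rational point `P` of `X` to the unit section whenever `f` does.  Engine: Stacks 01ZC for the subalgebra diagram
  `Spec K = lim_t Spec T[t]` (`Limits.SubalgApprox.exists_π_app_comp_eq`) through the dictionary `Q ×_T T′ → 𝒜` ↔ `Q_{T′} → 𝒜_{T′}`
  (`Limits.sliceHom`, `pullback_map_sliceHom`); the pointedness is read off after base change to `K` by Mathlib's
  `ext_of_isDominant_of_isSeparated` (`Spec K → Spec R` dominant, `Spec R` reduced, `𝒜_R` separated).
  `exists_stage_hom_baseChange_eq_of_algHom` is the `[Algebra k K]`-form.

HC_CM is proved only modulo the 7 printed citations until rung 0 closes; nothing here discharges a binder by itself.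

## References
* [EGAIV3] A. Grothendieck, J. Dieudonné, EGA IV₃ (Publ. Math. IHÉS 28, 1966), Thm. 8.8.2 (i).
* [StacksProject] The Stacks Project, Tag 01ZC.
* [GortzWedhorn2020] U. Görtz, T. Wedhorn, *Algebraic Geometry I*, 2nd ed. (2020), Thm. 10.57; Section (4.7), Prop. 4.16; Remark 16.54.
-/

set_option autoImplicit false

noncomputable section

universe u

open CategoryTheory CategoryTheory.Limits AlgebraicGeometry MonoidalCategory CartesianMonoidalCategory

namespace Literature.AlgebraicGeometry.AbelianSchemes

open Literature.AlgebraicGeometry.Motives (SchemeOver specOver AbelianVariety)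
open Literature.AlgebraicGeometry.Limits Literature.AlgebraicGeometry.Limits.SubalgApprox
open scoped MonObj Obj

namespace AbelianScheme

set_option backward.isDefEq.respectTransparency false

/-! ## §1 The fibre of a base change along a factorisation `T → R → κ` of `T → κ` -/

section FacIso

variable {T : Type u} [CommRing T] (𝒜 : AbelianScheme T) {R : Type u} [CommRing R] (φ : T →+* R)
  {κ : Type u} [Field κ] (χ : R →+* κ) (ψ : T →+* κ)

/-- `Spec χ ≫ Spec φ = Spec ψ` for `χ ∘ φ = ψ`. [cite: GortzWedhorn2020, Section (4.7)] -/
theorem specMap_comp_eq_specMap (h : χ.comp φ = ψ) : specMap χ ≫ specMap φ = specMap ψ := by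
  rw [← specMap_comp, h]

/-- The isomorphism of GROUP `κ`-schemes `((𝒜_R)_χ)^grp ≅ (𝒜_ψ)^grp` for a factorisation `ψ = χ ∘ φ`: the natural isomorphism
`Over.pullback (Spec φ) ⋙ Over.pullback (Spec χ) ≅ Over.pullback (Spec ψ)` WITH EXPLICIT PROJECTIONS (`Limits.pullbackFacIso`) is
monoidal for the cartesian structures, hence lifts to group objects (`Functor.mapGrpNatIso`, `Functor.mapGrpCompIso`).
[cite: GortzWedhorn2020, Section (4.7) and Remark 16.54] -/
def fibreFacGrpIso (h : χ.comp φ = ψ) : ((𝒜.baseChange φ).fibre χ).toGrp ≅ (𝒜.fibre ψ).toGrp :=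
  (Functor.mapGrpCompIso.symm ≪≫
      Functor.mapGrpNatIso (pullbackFacIso (specMap φ) (specMap χ) (specMap ψ)
        (specMap_comp_eq_specMap φ χ ψ h))).app 𝒜.toGrp

/-- **The fibre of `𝒜_R` at `χ : R → κ` is the fibre of `𝒜` at `ψ = χ ∘ φ : T → κ`**, as abelian varieties over `κ`, through the
transitivity isomorphism with explicit projections (`Limits.pullbackFacObjIso`; compare `fibreBaseChangeIso`, built on Mathlib's
`Over.pullbackComp`). [cite: GortzWedhorn2020, Section (4.7), Prop. 4.16] -/
def fibreFacIso (h : χ.comp φ = ψ) : (𝒜.baseChange φ).fibre χ ≅ 𝒜.fibre ψ :=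
  InducedCategory.isoMk (X := (𝒜.baseChange φ).fibre χ) (Y := 𝒜.fibre ψ) (𝒜.fibreFacGrpIso φ χ ψ h)

/-- The underlying morphism of `κ`-schemes of `fibreFacIso` is the transitivity isomorphism `pullbackFacObjIso` at `𝒜.X`.
[cite: GortzWedhorn2020, Section (4.7), Prop. 4.16] -/
theorem fibreFacIso_hom_hom_hom_hom (h : χ.comp φ = ψ) :
    (𝒜.fibreFacIso φ χ ψ h).hom.hom.hom.hom =
      (pullbackFacObjIso (specMap φ) (specMap χ) (specMap ψ) (specMap_comp_eq_specMap φ χ ψ h) 𝒜.X).hom := by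
  rfl

/-- The same for the inverse. [cite: GortzWedhorn2020, Section (4.7), Prop. 4.16] -/
theorem fibreFacIso_inv_hom_hom_hom (h : χ.comp φ = ψ) :
    (𝒜.fibreFacIso φ χ ψ h).inv.hom.hom.hom =
      (pullbackFacObjIso (specMap φ) (specMap χ) (specMap ψ) (specMap_comp_eq_specMap φ χ ψ h) 𝒜.X).inv := by
  rfl

/-- **Base change carries the unit morphism to the unit morphism**, in the `AbelianScheme`-typed form (the group law of
`𝒜_R` IS the transported one, `baseChange_grpObj`): Mathlib's `Functor.map_one` for the monoidal functor `Over.pullback (Spec φ)`.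
[cite: GortzWedhorn2020, Section (4.7) and Remark 16.54] -/
theorem pullback_map_one (Z : SchemeOver T) :
    (Over.pullback (specMap φ)).map (1 : Z ⟶ 𝒜.X) = (1 : (Over.pullback (specMap φ)).obj Z ⟶ (𝒜.baseChange φ).X) :=
  Functor.map_one _

end FacIso

/-! ## §2 Spreading out a morphism `X_K → 𝒜_K` to a stage `T ⊆ R ⊆ K` -/

section Spread

variable {k : Type u} [Field k] {K : Type u} [Field K] {T : Type u} [CommRing T] [Algebra k T]

/-- The comparison `(X_R)_K ≅ X_K` of iterated base changes for ring maps `k → R → K` composing to `σ : k → K`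
(`Limits.pullbackFacObjIso` with its explicit projections). [cite: GortzWedhorn2020, Section (4.7), Prop. 4.16] -/
def srcFacIso {R : Type u} [CommRing R] [Algebra k R] (χ : R →+* K) (σ : k →+* K)
    (hσ : χ.comp (algebraMap k R) = σ) (X : SchemeOver k) :
    (Over.pullback (specMap χ)).obj ((Over.pullback (specMap (algebraMap k R))).obj X) ≅
      (Over.pullback (specMap σ)).obj X :=
  pullbackFacObjIso (specMap (algebraMap k R)) (specMap χ) (specMap σ)
    (by rw [← specMap_comp, hσ]) X

set_option synthInstance.maxHeartbeats 40000 in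
/-- **Spreading out a morphism into an abelian scheme from the geometric generic fibre to a stage** (EGA IV₃ 8.8.2 (i) /
Stacks 01ZC for `Spec K = lim Spec T[t]` over the finitely generated `T`-subalgebras `T[t] ⊆ K`).  Let `T` be a domain of
finite type over a field `k` with an injective ring map `ψ : T → K` to a field, `σ = ψ ∘ (k → T)`, `𝒜` an abelian scheme over
`T` and `X` a quasi-compact quasi-separated `k`-scheme.  Every `K`-morphism `f : X_K → 𝒜_ψ = 𝒜 ×_{T,ψ} K` is, for some finitely
generated `T`-subalgebra `R ⊆ K` (again a domain of finite type over `k`; `φ : T → R`, `χ : R ⊆ K`, `χ ∘ φ = ψ`), the base change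
of an `R`-morphism `F : X_R → 𝒜_R` — precisely `F ×_R K = (X_R)_K ≅ X_K → 𝒜_ψ ≅ (𝒜_R)_χ` through the transitivity isomorphisms
`srcFacIso` / `fibreFacIso` — and `F` maps a rational point `P` of `X` to the unit section as soon as `f` does.
[cite: EGAIV3, Thm. 8.8.2 (i)] [cite: StacksProject, Tag 01ZC] [cite: GortzWedhorn2020, Thm. 10.57 and Section (4.7)] -/
theorem exists_stage_hom_baseChange_eq [Algebra.FiniteType k T] (ψ : T →+* K)
    (σ : k →+* K) (hσ : ψ.comp (algebraMap k T) = σ) (𝒜 : AbelianScheme T)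
    (X : SchemeOver k) [QuasiCompact X.hom] [QuasiSeparated X.hom]
    (f : (Over.pullback (specMap σ)).obj X ⟶ (𝒜.fibre ψ).X) :
    ∃ (R : Type u) (_ : CommRing R) (_ : IsDomain R) (_ : Algebra k R) (_ : Algebra.FiniteType k R)
      (φ : T →+* R) (_ : φ.comp (algebraMap k T) = algebraMap k R)
      (χ : R →+* K) (_ : Function.Injective χ) (hχ : χ.comp φ = ψ) (hσ' : χ.comp (algebraMap k R) = σ)
      (F : (Over.pullback (specMap (algebraMap k R))).obj X ⟶ (𝒜.baseChange φ).X),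
      (Over.pullback (specMap χ)).map F =
          (srcFacIso χ σ hσ' X).hom ≫ f ≫ (𝒜.fibreFacIso φ χ ψ hχ).inv.hom.hom.hom ∧
        ∀ P : 𝟙_ (SchemeOver k) ⟶ X, (Over.pullback (specMap σ)).map P ≫ f = 1 →
          (Over.pullback (specMap (algebraMap k R))).map P ≫ F = 1 := by
  classical
  -- `K` as a `T`-algebra through `ψ`
  letI : Algebra T K := ψ.toAlgebra
  -- the constant family `Q = X ×_k Spec T` and the `T`-scheme `Spec K`
  let sT : Spec (.of T) ⟶ Spec (.of k) := specMap (algebraMap k T)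
  let Q : SchemeOver T := (Over.pullback sT).obj X
  haveI : QuasiCompact Q.hom := inferInstanceAs (QuasiCompact (pullback.snd X.hom sT))
  haveI : QuasiSeparated Q.hom := inferInstanceAs (QuasiSeparated (pullback.snd X.hom sT))
  let TK : SchemeOver T := specOver T K
  have hTK : TK.hom = specMap ψ := rfl
  have hfacK : specMap ψ ≫ sT = specMap σ := by rw [← specMap_comp, hσ]
  -- `f` read as a `Spec K`-morphism between base changes along `TK.hom`, then as `g : Q ×_T Spec K → 𝒜` over `T`
  let iK : (Over.pullback TK.hom).obj Q ≅ (Over.pullback (specMap σ)).obj X := pullbackFacObjIso sT (specMap ψ) (specMap σ) hfacK X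
  let f' : (Over.pullback TK.hom).obj Q ⟶ (Over.pullback TK.hom).obj 𝒜.X := iK.hom ≫ f
  let g : Q ⊗ TK ⟶ 𝒜.X := unsliceHom TK f'
  -- Stacks 01ZC: `g` comes from a stage `T[t]`
  haveI := 𝒜.isSmooth
  haveI : LocallyOfFinitePresentation 𝒜.X.hom := inferInstance
  obtain ⟨t, gt, hgt, hgt'⟩ := SubalgApprox.exists_π_app_comp_eq (K := T) (B := K) (∅ : Finset K) Q (𝟙 _) 𝒜.X.hom g.left
    (by rw [Category.comp_id]; exact Over.w g)
  -- the stage `R = T[t] ⊆ K`, `φ : T → R`, `χ : R ⊆ K`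
  let R : Type u := ↥(sub T K t.unop.1)
  let Tt : SchemeOver T := (baseDiagram T K ∅).obj t
  letI : Algebra k R := ((algebraMap T R).comp (algebraMap k T)).toAlgebra
  haveI : IsScalarTower k T R := IsScalarTower.of_algebraMap_eq fun _ => rfl
  haveI : Algebra.FiniteType k R := Algebra.FiniteType.trans (S := T) inferInstance inferInstance
  let φ : T →+* R := algebraMap T R
  let χ : R →+* K := (sub T K t.unop.1).val.toRingHom
  have hχ : χ.comp φ = ψ := RingHom.ext fun _ => rfl
  have hσ' : χ.comp (algebraMap k R) = σ := by
    rw [show algebraMap k R = φ.comp (algebraMap k T) from rfl, ← RingHom.comp_assoc, hχ, hσ]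
  have hχinj : Function.Injective χ := Subtype.val_injective
  have hTt : Tt.hom = specMap φ := rfl
  have hleg : ((baseCone T K ∅).π.app t).left = specMap χ := rfl
  -- `gt` as a `T`-morphism `Q ⊗ Spec R → 𝒜`, restricting to `g` on `Q ⊗ Spec K`
  let gOver : Q ⊗ Tt ⟶ 𝒜.X := Over.homMk gt (by rw [hgt', Category.comp_id])
  have hres : Q ◁ (baseCone T K ∅).π.app t ≫ gOver = g := by
    ext : 1
    exact hgt
  -- the spread morphism over `R`
  let F₀ : (Over.pullback Tt.hom).obj Q ⟶ (Over.pullback Tt.hom).obj 𝒜.X := sliceHom Tt gOver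
  have hfacR : specMap φ ≫ sT = specMap (algebraMap k R) := by
    change Spec.map (CommRingCat.ofHom φ) ≫ Spec.map (CommRingCat.ofHom (algebraMap k T)) =
      Spec.map (CommRingCat.ofHom ((algebraMap T R).comp (algebraMap k T)))
    rw [← Spec.map_comp, ← CommRingCat.ofHom_comp]
  let iR : (Over.pullback (specMap φ)).obj Q ≅ (Over.pullback (specMap (algebraMap k R))).obj X :=
    pullbackFacObjIso sT (specMap φ) (specMap (algebraMap k R)) hfacR X
  let F : (Over.pullback (specMap (algebraMap k R))).obj X ⟶ (𝒜.baseChange φ).X := iR.inv ≫ F₀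
  -- the comparison over `K`
  have hmain : (Over.pullback (specMap χ)).map F =
      (srcFacIso χ σ hσ' X).hom ≫ f ≫ (𝒜.fibreFacIso φ χ ψ hχ).inv.hom.hom.hom := by
    -- functoriality of the dictionary `Q ⊗ T' → 𝒜` ↔ `Q_{T'} → 𝒜_{T'}` in `T'`, along `Spec K → Spec R`
    have h1 : (Over.pullback (specMap χ)).map F₀ ≫
        (pullbackFacObjIso (specMap φ) (specMap χ) (specMap ψ) (specMap_comp_eq_specMap φ χ ψ hχ) 𝒜.X).hom =
        (pullbackFacObjIso (specMap φ) (specMap χ) (specMap ψ) (specMap_comp_eq_specMap φ χ ψ hχ) Q).hom ≫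
          sliceHom TK (Q ◁ (baseCone T K ∅).π.app t ≫ gOver) :=
      pullback_map_sliceHom ((baseCone T K ∅).π.app t) (Q := Q) gOver
    rw [hres, show g = unsliceHom TK f' from rfl, sliceHom_unsliceHom] at h1
    have h2 := (Iso.eq_comp_inv _).mpr h1
    -- `h2 : (F₀)_K = jQ ≫ iK ≫ f ≫ jA⁻¹`
    rw [fibreFacIso_inv_hom_hom_hom, Functor.map_comp]
    erw [h2]
    simp only [Category.assoc]
    -- the source isomorphisms agree: `(iR⁻¹)_K ≫ jQ ≫ iK = srcFacIso`
    have hsrc : (Over.pullback (specMap χ)).map iR.inv ≫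
        (pullbackFacObjIso (specMap φ) (specMap χ) (specMap ψ) (specMap_comp_eq_specMap φ χ ψ hχ) Q).hom ≫ iK.hom =
          (srcFacIso χ σ hσ' X).hom := by
      rw [← cancel_epi ((Over.pullback (specMap χ)).map iR.hom), ← Functor.map_comp_assoc, Iso.hom_inv_id,
        CategoryTheory.Functor.map_id, Category.id_comp]
      ext : 1
      dsimp only [srcFacIso, iK, iR]
      apply pullback.hom_ext
      · simp only [Over.comp_left, Category.assoc, pullbackFacObjIso_hom_left_fst, Over.pullback_map_left,
          pullback.lift_fst_assoc]
        erw [pullbackFacObjIso_hom_left_fst_assoc]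
      · simp only [Over.comp_left, Category.assoc, pullbackFacObjIso_hom_left_snd, Over.pullback_map_left,
          pullback.lift_snd]
        erw [pullbackFacObjIso_hom_left_snd]
    have hf' : f' = iK.hom ≫ f := rfl
    rw [hf']
    simp only [Category.assoc]
    rw [reassoc_of% hsrc]
  refine ⟨R, inferInstance, inferInstance, inferInstance, inferInstance, φ, rfl, χ, hχinj, hχ, hσ', F, hmain, ?_⟩
  -- pointedness: compare after base change to `K`, then conclude by dominance of `Spec K → Spec R`
  intro P hP
  haveI : (Over.pullback (specMap χ)).Monoidal := inferInstance
  let U : Over (Spec (.of R)) := (Over.pullback (specMap (algebraMap k R))).obj (𝟙_ (SchemeOver k))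
  have hfacσ : specMap χ ≫ specMap (algebraMap k R) = specMap σ := by rw [← specMap_comp, hσ']
  haveI : IsMonHom (𝒜.fibreFacIso φ χ ψ hχ).inv.hom.hom.hom := (𝒜.fibreFacIso φ χ ψ hχ).inv.hom.hom.isMonHom_hom
  -- after base change to `K` both sides are the unit
  have key : (Over.pullback (specMap χ)).map ((Over.pullback (specMap (algebraMap k R))).map P ≫ F) =
      (1 : (Over.pullback (specMap χ)).obj U ⟶ ((𝒜.baseChange φ).fibre χ).X) := by
    have hnat := pullbackFacObjIso_naturality (specMap (algebraMap k R)) (specMap χ) (specMap σ) hfacσ P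
    rw [Functor.map_comp, hmain]
    dsimp only [srcFacIso]
    rw [reassoc_of% hnat, reassoc_of% hP, MonObj.one_comp, MonObj.comp_one]
  rw [← (𝒜.baseChange φ).pullback_map_one χ U] at key
  -- hence the two `R`-morphisms agree after the dominant `U_K → U`
  have key' : pullback.fst U.hom (specMap χ) ≫ ((Over.pullback (specMap (algebraMap k R))).map P ≫ F).left =
      pullback.fst U.hom (specMap χ) ≫ (1 : U ⟶ (𝒜.baseChange φ).X).left := by
    have h := congrArg (fun G => Over.Hom.left G ≫ pullback.fst _ _) key
    simpa only [Over.pullback_map_left, pullback.lift_fst] using h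
  -- instances: `U ≅ Spec R` is reduced, `𝒜_R` is separated, `U_K → U` is dominant
  haveI : IsIso U.hom := by
    change IsIso (pullback.snd (𝟙 (Spec (.of k))) (specMap (algebraMap k R)))
    infer_instance
  haveI : IsReduced U.left := isReduced_of_isOpenImmersion U.hom
  haveI := (𝒜.baseChange φ).isProper
  haveI : IsDominant (specMap χ) := by
    refine ⟨(PrimeSpectrum.denseRange_comap_iff_ker_le_nilRadical _).2 ?_⟩
    intro x hx
    have hx0 : x = 0 := hχinj (by simpa using hx)
    rw [hx0]
    exact zero_mem _
  haveI : IsDominant (pullback.fst U.hom (specMap χ)) := by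
    rw [← MorphismProperty.cancel_right_of_respectsIso @IsDominant _ U.hom, pullback.condition]
    infer_instance
  ext : 1
  exact ext_of_isDominant_of_isSeparated (𝒜.baseChange φ).X.hom (by rw [Over.w, Over.w])
    (pullback.fst U.hom (specMap χ)) key'

/-- **The same, for a `k`-embedded base**: `T` a finitely generated `k`-algebra with a `k`-algebra map `ψ : T → K` to a field
extension `K` of `k` (so `σ = algebraMap k K`); the stage `R` comes with `Algebra k R`, an injective `χ : R →ₐ[k] K` and
`χ ∘ φ = ψ`.  This is the shape produced by the abelian-scheme spread of a `K`-abelian variety over a finitely generated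
`k`-subalgebra of `K` (piece F2 of the III-0 road). [cite: EGAIV3, Thm. 8.8.2 (i)] [cite: StacksProject, Tag 01ZC] -/
theorem exists_stage_hom_baseChange_eq_of_algHom [Algebra k K] [Algebra.FiniteType k T] (ψ : T →ₐ[k] K)
    (𝒜 : AbelianScheme T) (X : SchemeOver k) [QuasiCompact X.hom] [QuasiSeparated X.hom]
    (f : (Over.pullback (specMap (algebraMap k K))).obj X ⟶ (𝒜.fibre ψ.toRingHom).X) :
    ∃ (R : Type u) (_ : CommRing R) (_ : IsDomain R) (_ : Algebra k R) (_ : Algebra.FiniteType k R)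
      (φ : T →+* R) (_ : φ.comp (algebraMap k T) = algebraMap k R)
      (χ : R →ₐ[k] K) (_ : Function.Injective χ) (hχ : χ.toRingHom.comp φ = ψ.toRingHom)
      (hσ' : χ.toRingHom.comp (algebraMap k R) = algebraMap k K)
      (F : (Over.pullback (specMap (algebraMap k R))).obj X ⟶ (𝒜.baseChange φ).X),
      (Over.pullback (specMap χ.toRingHom)).map F =
          (srcFacIso χ.toRingHom (algebraMap k K) hσ' X).hom ≫ f ≫ (𝒜.fibreFacIso φ χ.toRingHom ψ.toRingHom hχ).inv.hom.hom.hom ∧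
        ∀ P : 𝟙_ (SchemeOver k) ⟶ X, (Over.pullback (specMap (algebraMap k K))).map P ≫ f = 1 →
          (Over.pullback (specMap (algebraMap k R))).map P ≫ F = 1 := by
  obtain ⟨R, _, _, _, _, φ, hφ, χ, hχinj, hχ, hσ', F, hF, hP⟩ :=
    exists_stage_hom_baseChange_eq ψ.toRingHom (algebraMap k K) ψ.comp_algebraMap 𝒜 X f
  refine ⟨R, inferInstance, inferInstance, inferInstance, inferInstance, φ, hφ,
    { χ with commutes' := fun x => ?_ }, hχinj, hχ, hσ', F, hF, hP⟩
  exact RingHom.congr_fun hσ' x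

end Spread

end AbelianScheme

end Literature.AlgebraicGeometry.AbelianSchemes

end
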